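import Summits.BirchSwinnertonDyer.BirchSwinnertonDyer.Theorems.QuadraticBranchSignedControlPlusEtaNonsurjSteinbergHandleIdle
import Literature.NumberTheory.EllipticCurves.NeronComponentIndexSplitProofs
import Literature.NumberTheory.EllipticCurves.LocalTorsionMultiplicativeProofs
import Literature.NumberTheory.EllipticCurves.RootNumberTwistProofs
import Literature.NumberTheory.EllipticCurves.PastenValuationProductThm115Proofs
import Literature.NumberTheory.EllipticCurves.TamagawaNeZeroProofs
import HarnessLib

/-!
# Route `QuadraticBranchSignedControl` (rung K8, cell `bsd-potss`): crux stmt-BirchSwinnertonDyer-19606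
# `PlusEtaMainConjectureNonsurj` — THE TAMAGAWA LAW OF A ROW: at every split multiplicative place `v ∤ p` the local
# Tamagawa number `c_v = [V(ℚ_v) : V₀(ℚ_v)]` is DIVISIBLE BY `p` (kernel form of the class-wide θ₀-census of
# FINDING-19606-k8eta-c2-g11 §3: a rank-0 row has non-unit `L(V,1)/Ω_V` at `p = 5` exactly when it has a split
# multiplicative prime — 25/25 and 21/21 non-unit rows of the height-20 table, `v₅ = 1` each)

WHAT. On a row of crux 19606 (`V/ℚ` globally minimal, `p ≥ 5` good with `a_p = 0`, `p`-adic tower NOT onto) the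
mod-`p` representation is unramified at every multiplicative prime `ℓ ≠ p`, i.e. `p ∣ v_ℓ(Δ_min(V))`
(k8eta-c2 g9, `dvd_padicValInt_minimalDiscriminant_of_hasMultiplicativeReduction_of_row`, p571941: no transvection acts
on `V[p]`). By Kodaira–Néron / Tate (Silverman *ATAEC* Cor. IV.9.2 (d), tree theorem
`localTamagawaNumber_eq_ordMinimalDiscriminant_of_hasSplitMultiplicativeReductionAt`) the local Tamagawa number at a
SPLIT multiplicative place `v` is `c_v = ord_v(Δ_min)`. Hence:

* `dvd_localTamagawaNumber_of_hasSplitMultiplicativeReductionAt_of_row` — **`p ∣ c_v(V)` at every split multiplicative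
  place `v` of `V` with `v ∤ p`.** So on a row the `p`-part of the Tamagawa product is carried exactly by the split
  multiplicative primes (at a non-split multiplicative place `c_v ∈ {1, 2}`, at an additive place `c_v ≤ 4 < p`), and by
  the rank-`0` BSD formula the quotient `L(V,1)/Ω_V` (resp. `L(W,1)/Ω_W` for the additive partner `W = V ⊗ χ_p*`, whose
  multiplicative primes `≠ p` are those of `V`) is a `p`-adic NON-unit whenever such a place exists — the θ₀-level
  obstruction `λ⁺ + μ⁺ ≥ 1` on the corresponding branch of Kobayashi's `L_p⁺` (Kobayashi 2003 (3.5)–(3.6)), visible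
  class-wide in the g11 census (kit j293711: every non-unit rank-`0` value of the height-20 table has `5 ∣ Tam`).
* `localTamagawaNumber_le_two_or_dvd_of_hasMultiplicativeReductionAt_of_row` is NOT claimed here (the non-split value
  `c_v ∈ {1,2}` is not needed by the census statement and is left to the tree's Kodaira–Néron files).

HONEST FRAMING (cell `bsd-potss`, run/shared/lean/pub/bsd-potss/; FULL-BSD rank ≤ 1 programme): TOOL THEOREM ONLY
(no definition, no named fact, no `sorry`, axioms standard). Nothing is booked; crux 19606 stays OPEN; `BSD(W, p)` is
claimed for no pair. Seat `bsd-potss-k8eta-c2` g11 (prover), `--supports stmt-BirchSwinnertonDyer-19606`.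

References: [SilvermanATAEC1994] Cor. IV.9.2 (d), V.4–V.5; [Serre1972] §2.2; [Kobayashi2003] (3.5)–(3.6) (p. 7).
-/

set_option autoImplicit false
set_option linter.dupNamespace false

noncomputable section

open scoped Classical NumberField

open NumberField IsDedekindDomain Field WeierstrassCurve Literature.NumberTheory.EllipticCurves
  Literature.NumberTheory.SerreUniformity Rat.HeightOneSpectrum

namespace Summit.BirchSwinnertonDyer.BirchSwinnertonDyer.Theorems.EtaCartanField

/-- **Tamagawa law of a row of crux 19606.** For `V/ℚ` globally minimal, `p ≥ 5` good with `a_p = 0` and `p`-adic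
tower NOT onto, and every finite place `v` of `ℚ` of residue characteristic `≠ p` at which `V` has SPLIT multiplicative
reduction, `p` divides the local Tamagawa number `c_v = [V(ℚ_v) : V₀(ℚ_v)]`: indeed `c_v = ord_v(Δ_min(V))`
(Kodaira–Néron, type `Iₙ`) and `p ∣ ord_v(Δ_min(V))` because `ρ̄_{V,p}` is unramified at `v` (no transvection on an
`X_ns⁺(p)` row). [cite: SilvermanATAEC1994, Cor. IV.9.2 (d)] [cite: Serre1972, §2.2] -/
theorem dvd_localTamagawaNumber_of_hasSplitMultiplicativeReductionAt_of_row (V : WeierstrassCurve ℚ) [V.IsElliptic]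
    [V.IsGloballyMinimal] (p : ℕ) [Fact p.Prime] (hp5 : 5 ≤ p) (hgood : V.HasGoodReductionAtPrime p)
    (hap : V.frobeniusTrace p = 0) (hns : ¬ ∀ m : ℕ, V.HasSurjectiveModNGaloisRep (p ^ m : ℕ))
    (v : HeightOneSpectrum (𝓞 ℚ)) (hvp : (primesEquiv v : ℕ) ≠ p) (hs : V.HasSplitMultiplicativeReductionAt v) :
    p ∣ (V.baseChange (v.adicCompletion ℚ)).localTamagawaNumber (v.adicCompletionIntegers ℚ) := by
  haveI hℓ : Fact (primesEquiv v : ℕ).Prime := ⟨(primesEquiv v).2⟩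
  -- `c_v = ord_v(Δ_min) = v_ℓ(Δ_min)` with `ℓ` the residue characteristic of `v`
  rw [localTamagawaNumber_eq_ordMinimalDiscriminant_of_hasSplitMultiplicativeReductionAt v V hs,
    LocalTorsionMult.ordMinimalDiscriminant_eq_padicValInt V v (q := (primesEquiv v : ℕ)) rfl]
  -- split multiplicative at `v` ⟹ multiplicative at the prime `ℓ`
  have hmult : V.HasMultiplicativeReductionAtPrime (primesEquiv v : ℕ) :=
    (hasMultiplicativeReductionAtPrime_iff_hasMultiplicativeReductionAt_ringOfIntegers V v).mpr
      hs.hasMultiplicativeReductionAt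
  exact dvd_padicValInt_minimalDiscriminant_of_hasMultiplicativeReduction_of_row V p hp5 hgood hap hns
    (primesEquiv v : ℕ) hvp hmult

/-- **Contrapositive, census form**: on a row of crux 19606, a finite place `v ∤ p` whose local Tamagawa number is
PRIME TO `p` is not a place of split multiplicative reduction (so the `p`-adic units `L(V,1)/Ω_V` of the rank-`0`
census rows are exactly the rows without split multiplicative primes, given `Ш[p] = 0` and trivial `p`-torsion).
[cite: SilvermanATAEC1994, Cor. IV.9.2 (d)] [cite: Serre1972, §2.2] -/
theorem not_hasSplitMultiplicativeReductionAt_of_not_dvd_localTamagawaNumber_of_row (V : WeierstrassCurve ℚ)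
    [V.IsElliptic] [V.IsGloballyMinimal] (p : ℕ) [Fact p.Prime] (hp5 : 5 ≤ p)
    (hgood : V.HasGoodReductionAtPrime p) (hap : V.frobeniusTrace p = 0)
    (hns : ¬ ∀ m : ℕ, V.HasSurjectiveModNGaloisRep (p ^ m : ℕ)) (v : HeightOneSpectrum (𝓞 ℚ))
    (hvp : (primesEquiv v : ℕ) ≠ p)
    (hc : ¬ p ∣ (V.baseChange (v.adicCompletion ℚ)).localTamagawaNumber (v.adicCompletionIntegers ℚ)) :
    ¬ V.HasSplitMultiplicativeReductionAt v := fun hs =>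
  hc (dvd_localTamagawaNumber_of_hasSplitMultiplicativeReductionAt_of_row V p hp5 hgood hap hns v hvp hs)

/-- **The Tamagawa law is an EQUIVALENCE: on a row of crux 19606, for a finite place `v ∤ p`, `p ∣ c_v(V)` iff `V` has SPLIT
multiplicative reduction at `v`.** (`⇐` is `dvd_localTamagawaNumber_of_hasSplitMultiplicativeReductionAt_of_row`; `⇒`: at a place which
is not split multiplicative `c_v ≤ 4 < 5 ≤ p` by Kodaira–Néron, `localTamagawaNumber_le_four_of_not_hasSplitMultiplicativeReduction`, and
`c_v ≠ 0`.) So `v_p(Tam V) ≥ 1` exactly on the rows with a split multiplicative prime (FINDING-19606-k8eta-c2-g11 §2d: 36/102 and 31/95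
rank-0 rows at `p = 5`). Appended by seat `bsd-potss-k8eta-c2` g12. [cite: SilvermanATAEC1994, Cor. IV.9.2 (d)] [cite: Serre1972, §2.2] -/
theorem dvd_localTamagawaNumber_iff_hasSplitMultiplicativeReductionAt_of_row (V : WeierstrassCurve ℚ) [V.IsElliptic]
    [V.IsGloballyMinimal] (p : ℕ) [Fact p.Prime] (hp5 : 5 ≤ p) (hgood : V.HasGoodReductionAtPrime p)
    (hap : V.frobeniusTrace p = 0) (hns : ¬ ∀ m : ℕ, V.HasSurjectiveModNGaloisRep (p ^ m : ℕ)) (v : HeightOneSpectrum (𝓞 ℚ))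
    (hvp : (primesEquiv v : ℕ) ≠ p) :
    p ∣ (V.baseChange (v.adicCompletion ℚ)).localTamagawaNumber (v.adicCompletionIntegers ℚ) ↔
      V.HasSplitMultiplicativeReductionAt v := by
  refine ⟨fun h => ?_, dvd_localTamagawaNumber_of_hasSplitMultiplicativeReductionAt_of_row V p hp5 hgood hap hns v hvp⟩
  by_contra hs
  have h4 : (V.baseChange (v.adicCompletion ℚ)).localTamagawaNumber (v.adicCompletionIntegers ℚ) ≤ 4 :=
    localTamagawaNumber_le_four_of_not_hasSplitMultiplicativeReduction (v.adicCompletionIntegers ℚ)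
      (V.baseChange (v.adicCompletion ℚ)) hs
  have h0 : (V.baseChange (v.adicCompletion ℚ)).localTamagawaNumber (v.adicCompletionIntegers ℚ) ≠ 0 :=
    localTamagawaNumber_ne_zero_holds (v.adicCompletionIntegers ℚ) (V.baseChange (v.adicCompletion ℚ))
  have := Nat.le_of_dvd (Nat.pos_of_ne_zero h0) h
  omega

/-- **Census form: `p ∤ c_v(V)` at every place `v ∤ p` which is NOT split multiplicative** (additive, non-split multiplicative or good), on a
row of crux 19606 (`p ≥ 5 > 4 ≥ c_v`). [cite: SilvermanATAEC1994, Cor. IV.9.2 (d)] -/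
theorem not_dvd_localTamagawaNumber_of_not_hasSplitMultiplicativeReductionAt_of_row (V : WeierstrassCurve ℚ) [V.IsElliptic]
    [V.IsGloballyMinimal] (p : ℕ) [Fact p.Prime] (hp5 : 5 ≤ p) (hgood : V.HasGoodReductionAtPrime p)
    (hap : V.frobeniusTrace p = 0) (hns : ¬ ∀ m : ℕ, V.HasSurjectiveModNGaloisRep (p ^ m : ℕ)) (v : HeightOneSpectrum (𝓞 ℚ))
    (hvp : (primesEquiv v : ℕ) ≠ p) (hs : ¬ V.HasSplitMultiplicativeReductionAt v) :
    ¬ p ∣ (V.baseChange (v.adicCompletion ℚ)).localTamagawaNumber (v.adicCompletionIntegers ℚ) := fun h =>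
  hs ((dvd_localTamagawaNumber_iff_hasSplitMultiplicativeReductionAt_of_row V p hp5 hgood hap hns v hvp).mp h)

end Summit.BirchSwinnertonDyer.BirchSwinnertonDyer.Theorems.EtaCartanField

end
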